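import Summits.RiemannHypothesis.RiemannHypothesis.Theorems.WeilParityEvenWinsBeyondArchParityCell91
import Summits.RiemannHypothesis.RiemannHypothesis.Theorems.GroundBartaEvenWinsBeyondArchUpper91Sharp
import Summits.RiemannHypothesis.RiemannHypothesis.Theorems.WeilFormatCDataO94OddRung
import Summits.RiemannHypothesis.RiemannHypothesis.Theorems.WeilGroundStateGroundStateSimpleEvenCellTransfer
import Literature.NumberTheory.LFunctions.WeilGroundEnergyParitySplit
import HarnessLib

/-!
# RiemannHypothesis / GroundBarta — the parity ladder: PARITY CELL 10 `(91/100, 47/50]` CLOSED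

Helper file (`--supports stmt-RiemannHypothesis-18085`, `NoParityCrossing`), RH-free.  Prover A (g22 of unit `sr-gb-rung-a`).

The ladder step on `[91/100, 47/50]` (`ε`, `ε_od` antitone; `GroundStateSimpleEven.weilWindowSimpleEven_on_cell_of_le`, the
mechanism of `…LadderStep`'s `weilWindowSimpleEven_upTo_step`, inlined here) from three tree facts:
* the ladder up to `91/100`: `weilWindowSimpleEven_upTo_91` (`…ParityCell91`, cells 7–9);
* the U-side at `91/100`: `trialUpper91sharp : ε(91/100) ≤ 2589·10⁻²⁶` (`…Upper91Sharp`, Ritz vector `ne91v1`);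
* the L-side at `47/50`: `WeilFormatCData.O94.weilOddGroundEnergy_94_ge_inv_two_pow_75 : 2⁻⁷⁵ ≤ ε_od(47/50)`
  (`WeilFormatCDataO94OddRung`, the format-C ODD λ-run at `a = 47/50`, odd block `160`, `μ = 2⁻⁷⁵ = 2.65·10⁻²³ > 2589·10⁻²⁶`).

* `weilWindowSimpleEven_upTo_94` — for every `0 < a ≤ 47/50` the ground state of the windowed Weil form is simple and even;
* `weilEvenGroundEnergy_lt_weilOddGroundEnergy_upTo_94`, `tailSimpleEven_upTo_94` — the strict parity order / the item-18085 tail shape.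

Standard axioms; nothing is defined; no RH claim (a finite-range parity certificate).
-/

set_option linter.dupNamespace false

noncomputable section

open Set MeasureTheory

namespace Summit.RiemannHypothesis.RiemannHypothesis.Theorems.EvenWinsBeyondArch

open Literature.NumberTheory.LFunctions

/-- **Parity cell 10 closed: the ladder reaches `47/50`.**  For every window `0 < a ≤ 47/50` the windowed Weil form has a simple,
even ground state. [folklore] -/
theorem weilWindowSimpleEven_upTo_94 : ∀ a : ℝ, 0 < a → a ≤ 47 / 50 → WeilWindowSimpleEven a := by
  intro a ha hac
  rcases le_or_gt a (91 / 100) with hab | hba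
  · exact weilWindowSimpleEven_upTo_91 a ha hab
  · have hU := trialUpper91sharp
    have hL := WeilFormatCData.O94.weilOddGroundEnergy_94_ge_inv_two_pow_75
    have hUL : (2589 / 100000000000000000000000000 : ℝ) < (1 / 2 ^ 75 : ℝ) := by norm_num
    exact GroundStateSimpleEven.weilWindowSimpleEven_on_cell_of_le (b := 91 / 100) (c := 47 / 50) (by norm_num) hUL hU
      (fun _ hg hs hn ho ↦ hL.trans (weilOddGroundEnergy_le hg hs ho hn)) hba.le hac

/-- The strict parity order `ε_ev(a) < ε_od(a)` for every `0 < a ≤ 47/50`. [folklore] -/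
theorem weilEvenGroundEnergy_lt_weilOddGroundEnergy_upTo_94 {a : ℝ} (ha : 0 < a) (hle : a ≤ 47 / 50) :
    weilEvenGroundEnergy a < weilOddGroundEnergy a :=
  (weilWindowSimpleEven_iff_weilEvenGroundEnergy_lt ha).1 (weilWindowSimpleEven_upTo_94 a ha hle)

/-- Tail shape of item 18085 up to `47/50`: simple even ground states on every window `log 2 < a ≤ 47/50`. [folklore] -/
theorem tailSimpleEven_upTo_94 : ∀ a : ℝ, Real.log 2 < a → a ≤ 47 / 50 → WeilWindowSimpleEven a :=
  fun a ha hle ↦ weilWindowSimpleEven_upTo_94 a ((Real.log_pos (by norm_num)).trans ha) hle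

end Summit.RiemannHypothesis.RiemannHypothesis.Theorems.EvenWinsBeyondArch

end
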